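import Summits.QuantumFields.YangMills.Theses.TypicalExteriorCeilings
import Summits.QuantumFields.YangMills.Theorems.InfiniteVolumePerOrderIVData

/-!
# Route `TypicalExteriorCeilings` — the support item `FactorialCalibration` (stmt-QuantumFields-25894), PROVED
# (also BY NAME `AntiScreeningCeilings.FactorialCalibrationC` ∕ `SquareRootCeilings`, stmt-QuantumFields-26673)

`FactorialCalibration`: the FACTORIAL-TOLERANT sub-onset ceilings (the conclusion of the landed support
`HolderTransfer`: centred mixed plane moments `≤ (C n^κ/R⁴)ⁿ` at every sub-onset resolution) → `OnsetFloors` →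
`OnsetVanishes` → the leaf `InfiniteVolumeContinuum.HypercubicOSDataFromInfiniteVolume` (rung R2a-IV).

Proof = verbatim the CALIBRATION of the landed `OnsetCalibration.assembly_proof` (unit `a(β)` = an onset resolution
above half the top of the onset set; `a → 0` by `OnsetVanishes`; floors at `a` by membership; ceilings at `a` because
every `s' ≥ 2a(β)` carries no floor), with the infinite-volume engine re-run with the PER-ORDER collar constant
`Cn n = C·n^κ` (`InfiniteVolume.PerOrder.ivData_perOrder`; files `InfiniteVolumePerOrder{Compactness,TorusScheme,
CentreBase,IVData}`): compactness, the junction and the centre/base transfer are order-by-order, and the E0′ output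
`‖S₁ n F‖ ≤ 5(A + B·C n^κ)ⁿ‖F‖_{10n}` is still of linear growth — `(A + BCn^κ)ⁿ ≤ (Mn^κ)ⁿ ≤ e^{Me^κ}(n!)^{1+κ}`
(`nⁿ ≤ eⁿ n!`), i.e. `HasLinearGrowth` with exponent `1 + κ` (`pow_affine_rpow_le_factorial`).  Reflection positivity,
hermiticity and the hyperoctahedral invariance are the landed `InfVolRP.rpPos_of_oddTorusLimitStates_centre`,
`isHermitian_of_isReflectionPositive`, `InfiniteVolume.E1.stub_ivSigned` BY NAME.

HONEST LABEL: this closes only a glue item; the leaf then rests on the OPEN cruxes `AnnealedBoundaryLaw` (annealed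
sub-onset boundary law, open-problem class) and `OnsetFloors` (= the NT residual of the ladder).  No summit, no mass
gap and no Clay statement is proved here; rung R2a RECORD label only.

References: K. Osterwalder, R. Schrader, CMP 42 (1975) 281–305 [OsterwalderSchrader1975] (§2, E0′);
P. Kravchuk, J. Qiao, S. Rychkov, arXiv:2104.02090 [KravchukQiaoRychkov2021] ((9.18)); J. Glimm, A. Jaffe,
Quantum Physics (1987) §6.1 [GlimmJaffe1987].
-/

set_option autoImplicit false

noncomputable section

open scoped BigOperators SchwartzMap
open MeasureTheory Filter Topology
open Literature.MathematicalPhysics.QuantumFieldTheory Literature.MathematicalPhysics.QuantumLattice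
open Literature.MathematicalPhysics.AQFT
open Literature.Probability.LatticeModels (Site)
open Summit.QuantumFields.YangMills.Cruxes.OSLegsFromFemtoAndGap.DlrCollarTransfer
open Summit.QuantumFields.YangMills.Theorems.InfiniteVolume (stateMomentStr)
open Summit.QuantumFields.YangMills.Theorems.InfVolRP
open Summit.QuantumFields.YangMills.Theorems.OSLegsFromFemtoAndGap (pow_le_exp_mul_factorial)

namespace Summit.QuantumFields.YangMills.Theorems.TypicalExteriorCeilings

/-- **Factorial currency is of linear growth**: for `A, B, C, κ ≥ 0` and every `n`,
`(A + B·(C·n^κ))ⁿ ≤ e^{(A+BC)e^κ}·(n!)^{1+κ}` (`A + BCn^κ ≤ (A+BC)n^κ` for `n ≥ 1`, `(n^κ)ⁿ = (nⁿ)^κ`, `nⁿ ≤ eⁿ·n!`,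
`xⁿ ≤ eˣ·n!`). [folklore] -/
theorem pow_affine_rpow_le_factorial {A B C κ : ℝ} (hA : 0 ≤ A) (hB : 0 ≤ B) (hC : 0 ≤ C) (hκ : 0 ≤ κ) (n : ℕ) :
    (A + B * (C * (n : ℝ) ^ κ)) ^ n ≤ Real.exp ((A + B * C) * Real.exp κ) * ((n.factorial : ℝ)) ^ (1 + κ) := by
  rcases Nat.eq_zero_or_pos n with rfl | hn
  · simp only [pow_zero, Nat.factorial_zero, Nat.cast_one, Real.one_rpow, mul_one]
    exact Real.one_le_exp (by positivity)
  have hn1 : (1 : ℝ) ≤ n := by exact_mod_cast hn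
  have hn0 : (0 : ℝ) ≤ n := by positivity
  have hnk : 1 ≤ (n : ℝ) ^ κ := Real.one_le_rpow hn1 hκ
  have hfac : (0 : ℝ) < n.factorial := by exact_mod_cast n.factorial_pos
  set M : ℝ := A + B * C with hM
  have hM0 : 0 ≤ M := by positivity
  -- `A + BCn^κ ≤ M n^κ`
  have h1 : A + B * (C * (n : ℝ) ^ κ) ≤ M * (n : ℝ) ^ κ := by
    have hA' : A ≤ A * (n : ℝ) ^ κ := le_mul_of_one_le_right hA hnk
    have : M * (n : ℝ) ^ κ = A * (n : ℝ) ^ κ + B * (C * (n : ℝ) ^ κ) := by rw [hM]; ring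
    linarith
  have h2 : (A + B * (C * (n : ℝ) ^ κ)) ^ n ≤ (M * (n : ℝ) ^ κ) ^ n := pow_le_pow_left₀ (by positivity) h1 n
  -- `(n^κ)ⁿ = (nⁿ)^κ ≤ (eⁿ·n!)^κ = (e^κ)ⁿ·(n!)^κ`
  have h3 : ((n : ℝ) ^ κ) ^ n = ((n : ℝ) ^ n) ^ κ := by
    rw [← Real.rpow_natCast ((n : ℝ) ^ κ) n, ← Real.rpow_mul hn0, mul_comm, Real.rpow_mul hn0, Real.rpow_natCast]
  have h4 : (n : ℝ) ^ n ≤ Real.exp n * n.factorial := pow_le_exp_mul_factorial hn0 n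
  have h5 : ((n : ℝ) ^ n) ^ κ ≤ (Real.exp n * n.factorial) ^ κ := Real.rpow_le_rpow (by positivity) h4 hκ
  have h6 : (Real.exp n * (n.factorial : ℝ)) ^ κ = Real.exp κ ^ n * (n.factorial : ℝ) ^ κ := by
    rw [Real.mul_rpow (Real.exp_pos _).le hfac.le, ← Real.exp_mul, mul_comm (n : ℝ) κ, Real.exp_mul,
      Real.rpow_natCast]
  -- `(M e^κ)ⁿ ≤ e^{M e^κ}·n!`
  have h7 : (M * Real.exp κ) ^ n ≤ Real.exp (M * Real.exp κ) * n.factorial :=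
    pow_le_exp_mul_factorial (by positivity) n
  have h8 : ((n.factorial : ℝ)) ^ (1 + κ) = (n.factorial : ℝ) * (n.factorial : ℝ) ^ κ := by
    rw [Real.rpow_add hfac, Real.rpow_one]
  calc (A + B * (C * (n : ℝ) ^ κ)) ^ n ≤ (M * (n : ℝ) ^ κ) ^ n := h2
    _ = M ^ n * ((n : ℝ) ^ n) ^ κ := by rw [mul_pow, h3]
    _ ≤ M ^ n * (Real.exp κ ^ n * (n.factorial : ℝ) ^ κ) := by
        rw [← h6]; exact mul_le_mul_of_nonneg_left h5 (pow_nonneg hM0 n)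
    _ = (M * Real.exp κ) ^ n * (n.factorial : ℝ) ^ κ := by rw [mul_pow]; ring
    _ ≤ (Real.exp (M * Real.exp κ) * n.factorial) * (n.factorial : ℝ) ^ κ :=
        mul_le_mul_of_nonneg_right h7 (Real.rpow_nonneg hfac.le _)
    _ = Real.exp (M * Real.exp κ) * ((n.factorial : ℝ)) ^ (1 + κ) := by rw [h8]; ring

/-- **Support `FactorialCalibration` of route `TypicalExteriorCeilings`** (stmt-QuantumFields-25894): factorial-tolerant
sub-onset ceilings → `OnsetFloors` → `OnsetVanishes` → `HypercubicOSDataFromInfiniteVolume`, by the calibration of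
`OnsetCalibration.assembly_proof` run with the per-order infinite-volume engine.  Glue only: the leaf stays conditional
on the open cruxes `AnnealedBoundaryLaw` and `OnsetFloors`. -/
theorem factorialCalibration_proof :
    Summit.QuantumFields.YangMills.Theses.TypicalExteriorCeilings.FactorialCalibration := by
  unfold Summit.QuantumFields.YangMills.Theses.TypicalExteriorCeilings.FactorialCalibration
  intro hK2 hK1 hU G _ _ _ _ hG hcl
  letI : MeasurableSpace G := borel G
  haveI : BorelSpace G := ⟨rfl⟩
  -- K1: the floor datum
  obtain ⟨r, v, f, g, h, ε₁, Λ₅, β₅, hv, hfg, hgh, hfh, hε₁, hfloor⟩ := hK1 G hG hcl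
  -- the factorial ceilings at that datum: the admissible floor levels
  obtain ⟨ε₀, hε₀, hK2'⟩ := hK2 G hG hcl r v f g h Λ₅
  have hεpos : 0 < min ε₁ ε₀ := lt_min hε₁ hε₀
  -- the level `ε := min ε₁ ε₀` is live from `β₅` on
  have hlive : ∀ β : ℝ, β₅ ≤ β → ∃ s : ℝ, 0 < s ∧ s ≤ 1 ∧
      (∀ L : ℕ, Λ₅ ≤ s * L → min ε₁ ε₀ ≤ Q2 G r β L s (thetaTest 4 v) v) ∧
      (∀ L : ℕ, Λ₅ ≤ s * L → min ε₁ ε₀ ≤ |Q3 G r β L s f g h|) := by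
    intro β hβ
    obtain ⟨s, hs0, hs1, h2, h3⟩ := hfloor β hβ
    exact ⟨s, hs0, hs1, fun L hL => (min_le_left _ _).trans (h2 L hL),
      fun L hL => (min_le_left _ _).trans (h3 L hL)⟩
  obtain ⟨C, κ, ℓ₄, β₄, hℓ₄, hC, hκ, hceil⟩ := hK2' (min ε₁ ε₀) hεpos (min_le_right _ _) ⟨β₅, hlive⟩
  -- the onset set `S β` (opaque, with its membership lemma)
  obtain ⟨S, hS⟩ : ∃ S : ℝ → Set ℝ, ∀ β s, s ∈ S β ↔ (0 < s ∧ s ≤ 1 ∧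
      (∀ L : ℕ, Λ₅ ≤ s * L → min ε₁ ε₀ ≤ Q2 G r β L s (thetaTest 4 v) v) ∧
      (∀ L : ℕ, Λ₅ ≤ s * L → min ε₁ ε₀ ≤ |Q3 G r β L s f g h|)) :=
    ⟨fun β => {s | 0 < s ∧ s ≤ 1 ∧
      (∀ L : ℕ, Λ₅ ≤ s * L → min ε₁ ε₀ ≤ Q2 G r β L s (thetaTest 4 v) v) ∧
      (∀ L : ℕ, Λ₅ ≤ s * L → min ε₁ ε₀ ≤ |Q3 G r β L s f g h|)}, fun _ _ => Iff.rfl⟩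
  have hSbdd : ∀ β, BddAbove (S β) := fun β => ⟨1, fun s hs => ((hS β s).1 hs).2.1⟩
  have hSne : ∀ β : ℝ, β₅ ≤ β → (S β).Nonempty := fun β hβ => by
    obtain ⟨s, hs0, hs1, h2, h3⟩ := hlive β hβ
    exact ⟨s, (hS β s).2 ⟨hs0, hs1, h2, h3⟩⟩
  -- the calibrated unit: an onset resolution above half the top of the onset set
  have hex : ∀ β : ℝ, ∃ s : ℝ, 0 < s ∧ ((S β).Nonempty → s ∈ S β ∧ sSup (S β) / 2 < s) := by
    intro β
    by_cases hne : (S β).Nonempty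
    · have hpos : 0 < sSup (S β) := by
        obtain ⟨s, hs⟩ := hne
        exact lt_of_lt_of_le ((hS β s).1 hs).1 (le_csSup (hSbdd β) hs)
      obtain ⟨s, hs, hlt⟩ := exists_lt_of_lt_csSup hne (show sSup (S β) / 2 < sSup (S β) by linarith)
      exact ⟨s, ((hS β s).1 hs).1, fun _ => ⟨hs, hlt⟩⟩
    · exact ⟨1, one_pos, fun h' => (hne h').elim⟩
  choose a ha_pos ha_mem using hex
  -- U: the unit tends to zero
  have ha0 : Tendsto a atTop (nhds 0) := by
    rw [Metric.tendsto_atTop]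
    intro s₀ hs₀
    obtain ⟨β₁, hβ₁⟩ := hU G hG hcl r v f g h (min ε₁ ε₀) Λ₅ s₀ hεpos hs₀
    refine ⟨max β₁ β₅, fun β hβ => ?_⟩
    have hmem := (hS β (a β)).1 ((ha_mem β (hSne β (le_of_max_le_right hβ))).1)
    rw [Real.dist_0_eq_abs, abs_of_pos (ha_pos β)]
    exact lt_of_not_ge fun hcon => hβ₁ β (le_of_max_le_left hβ) (a β) hcon hmem.2.1 ⟨hmem.2.2.1, hmem.2.2.2⟩
  -- the floors at the calibrated unit, by membership
  have hlb : LowerBounds G r a := by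
    refine ⟨⟨v, min ε₁ ε₀, β₅, Λ₅, hv, hεpos, fun β hβ L hL => ?_⟩,
      ⟨f, g, h, min ε₁ ε₀, β₅, Λ₅, hfg, hgh, hfh, hεpos, fun β hβ L hL => ?_⟩⟩
    · have hmem := (hS β (a β)).1 ((ha_mem β (hSne β hβ)).1)
      exact hmem.2.2.1 L hL
    · have hmem := (hS β (a β)).1 ((ha_mem β (hSne β hβ)).1)
      exact hmem.2.2.2 L hL
  -- the FACTORIAL ceilings at the calibrated unit (per-order collar constant `C n^κ`):
  -- every `s' ≥ 2 a β` lies above the onset set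
  have hmb : ∀ β : ℝ, max β₄ β₅ ≤ β →
      ∀ (L n : ℕ) (q : Fin n → Fin 4 × Fin 4) (x : Fin n → (Fin 4 → ℤ)) (R : ℕ), (∀ i, (q i).1 < (q i).2) →
        1 ≤ R → (R : ℝ) * a β ≤ ℓ₄ → 4 * R + 8 ≤ L →
        (∀ i j : Fin n, i ≠ j → ∃ k : Fin 4,
          (2 * (R : ℤ) + 4) ≤ |((((x i k - x j k : ℤ) : ZMod (2 * L + 1))).valMinAbs : ℤ)|) →
        |torusE G r β L (fun U => ∏ i, (plane G r (q i) (x i) U - torusE G r β L (plane G r (q i) (x i))))| ≤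
          (C * (n : ℝ) ^ κ / (R : ℝ) ^ 4) ^ n := by
    intro β hβ L n q x R hq hR hRa hRL hsep
    have hne := hSne β (le_of_max_le_right hβ)
    have hmem := (hS β (a β)).1 ((ha_mem β hne).1)
    have hhalf := (ha_mem β hne).2
    refine hceil β (le_of_max_le_left hβ) (a β) hmem.1 hmem.2.1 ?_ L n q x R hq hR hRa hRL hsep
    intro s' h2s hs1 hFl
    have hs'mem : s' ∈ S β := (hS β s').2 ⟨by linarith [ha_pos β], hs1, hFl.1, hFl.2⟩
    have := le_csSup (hSbdd β) hs'mem
    linarith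
  -- the per-order infinite-volume engine
  obtain ⟨βk, μ, S₁, T, hdata, hN, ⟨A, B, hA, hB, hbd⟩, hSym, hTr, hNT, hNG⟩ :=
    Summit.QuantumFields.YangMills.Theorems.InfiniteVolume.PerOrder.ivData_perOrder r a ha_pos ha0 hlb
      (fun n => C * (n : ℝ) ^ κ) hℓ₄ (fun n => by positivity) hmb
  obtain ⟨hβ, hμ, h0, h1, hS', hT⟩ := id hdata
  -- a faithful continuous matrix representation of the compact group makes it Hausdorff and second countable
  haveI : T2Space G := (r.continuous.isClosedEmbedding r.injective).isEmbedding.t2Space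
  haveI : SecondCountableTopology G :=
    (r.continuous.isClosedEmbedding r.injective).isEmbedding.secondCountableTopology
  -- E2: exact lattice reflection positivity inherited along the limit (landed, BY NAME)
  have hβev : ∀ᶠ k in atTop, 0 ≤ βk k := hβ.eventually_ge_atTop 0
  have hrp := rpPos_of_oddTorusLimitStates_centre r hβev μ hμ (fun k => ha_pos (βk k)) (ha0.comp hβ) T
    (fun n hn q hq F hF => by
      have hpt : ∀ (k : ℕ) (x : Fin n → Site 4),
          (fun l => a (βk k) • (siteToE (x l) + centreOffset (q l))) =
            fun l => a (βk k) • siteToE (x l) +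
              (a (βk k) / 2) • (EuclideanSpace.single (q l).1 (1 : ℝ) + EuclideanSpace.single (q l).2 (1 : ℝ)) :=
        fun k x => funext fun l => by
          unfold centreOffset
          rw [if_pos (hq l), smul_add, smul_smul, mul_one_div]
      simp_rw [hpt]
      exact hT n hn q hq F hF) S₁ hS' h0 h1
  have hE2 := hrp.2
  have hE0h := Summit.QuantumFields.YangMills.Theorems.OSLegsFromFemtoAndGap.isHermitian_of_isReflectionPositive
    S₁ hN hE2
  -- E0′: the factorial currency is of linear growth, exponent `1 + κ`
  have hLG : S₁.toLabelled.HasLinearGrowth := by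
    intro _
    refine ⟨10, 5 * Real.exp ((A + B * C) * Real.exp κ), 1 + κ, fun n k _ F _ => ?_⟩
    simp only [SchwingerFamily.toLabelled_apply]
    calc ‖S₁ n F‖ ≤ 5 * (A + B * (C * (n : ℝ) ^ κ)) ^ n * schwartzNorm (10 * n) F := hbd n F
      _ ≤ 5 * (Real.exp ((A + B * C) * Real.exp κ) * ((n.factorial : ℝ)) ^ (1 + κ)) * schwartzNorm (10 * n) F := by
          gcongr
          · exact schwartzNorm_nonneg _ _
          · exact pow_affine_rpow_le_factorial hA hB hC hκ n
      _ = 5 * Real.exp ((A + B * C) * Real.exp κ) * ((n.factorial : ℝ)) ^ (1 + κ) * schwartzNorm (n * 10) F := by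
          rw [mul_comm n 10]; ring
  -- hyperoctahedral invariance on ⁰𝒮: exact on the lattice, passes to the limit (E1.stub_ivSigned, by name)
  have hW4 := Summit.QuantumFields.YangMills.Theorems.InfiniteVolume.E1.stub_ivSigned r a βk μ S₁ T ha_pos hμ h0 h1
    hS' hT
  exact ⟨r, a, βk, μ, S₁, T, ha_pos, ha0, hdata, hN, hE0h, hLG, fun R hR n F hF => hW4 R hR n F hF, hE2, hSym,
    hTr, hNT, hNG⟩

end Summit.QuantumFields.YangMills.Theorems.TypicalExteriorCeilings

end
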